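import Mathlib.Topology.ContinuousMap.Bounded.ArzelaAscoli
import Mathlib.Topology.MetricSpace.UniformConvergence
import Mathlib.Analysis.Calculus.MeanValue
import Mathlib.Analysis.Calculus.UniformLimitsDeriv
import Mathlib.Analysis.Calculus.ContDiff.Defs
import Mathlib.Analysis.Calculus.ContDiff.Basic
import Mathlib.Analysis.Calculus.ContDiff.Comp
import Mathlib.Analysis.Calculus.Gradient.Basic
import Mathlib.Analysis.InnerProductSpace.PiL2
import Mathlib.Analysis.InnerProductSpace.Laplacian
import Mathlib.Analysis.Normed.Module.FiniteDimension
import Mathlib.Topology.Algebra.Module.FiniteDimension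
import Mathlib.LinearAlgebra.Trace
import HarnessLib

/-!
# Compactness tools for the one-slice regularity criterion of Pineau–Vicol (2026)

Generic analysis used in the compactness proof of the one-slice vorticity smallness
(`pineauVicol_oneSlice_vorticity_small`, file `PineauVicolOneSliceVorticity`), which replaces
the principal-eigenfunction argument of [PineauVicol2026, §9.3] in the proof of Theorem 1.9
(`pineauVicol2026_oneSlice_regularity`):

* `exists_subseq_tendstoUniformlyOn_of_bounds` — `C²_loc` compactness of a sequence
  `Fₙ : ℝ³ → ℝ³` with locally uniform `C³` bounds (Arzelà–Ascoli for the bundle `(F, DF, D²F)` on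
  each closed ball, and a diagonal extraction through Tychonoff's theorem);
* `hasFDerivAt_limits_of_tendstoUniformlyOn` — the limits are the derivatives of the limit,
  which is `C²`;
* `tendstoUniformlyOn_clm_apply_of_bound`, `tendstoUniformlyOn_clm_apply_const`,
  `norm_le_of_tendstoUniformlyOn` — algebra of uniform limits;
* `exists_hasGradientAt_of_tendstoUniformlyOn` — a locally uniform limit of gradient fields is
  a gradient field (recovery of the limiting pressure);
* `laplacian_apply_eq_sum_fderiv_fderiv_basisFun`, `continuous_trace_clm`, `contDiff_one_of_hasGradientAt`.

All statements are folklore real analysis; no new facts are introduced.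

## References

* B. Pineau, V. Vicol, *On rotated backwards self-similar solutions of the incompressible 3D
  Navier–Stokes equations*, arXiv:2607.09619 (2026), §9.3. [PineauVicol2026]
-/

noncomputable section

open Set Function Filter Metric TopologicalSpace BoundedContinuousFunction InnerProductSpace
open _root_.Topology
open scoped NNReal Laplacian

namespace Literature.Analysis.FluidPDE

section C2Compactness

-- the bundle of values and two derivatives
set_option maxSynthPendingDepth 3

set_option maxHeartbeats 1600000 in

/-- **`C²_loc` compactness from uniform `C³` bounds on balls** (Arzelà–Ascoli and a diagonal
argument): if `Fₙ : ℝ³ → ℝ³` are `C³` and, on each closed ball `B̄(0, m+1)`, eventually in `n`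
the values and the first three derivatives of `Fₙ` are bounded by a constant depending on
`m` only, then along a subsequence `F_{φ n}`, `DF_{φ n}`, `D²F_{φ n}` converge uniformly on every
`B̄(0, m+1)` (Arzelà–Ascoli on each ball for the bundle `(F, DF, D²F)`, equicontinuous by the
mean value inequality, and Tychonoff's theorem on the countable product to extract one
subsequence for all balls at once). [folklore] -/
theorem exists_subseq_tendstoUniformlyOn_of_bounds
    (F : ℕ → EuclideanSpace ℝ (Fin 3) → EuclideanSpace ℝ (Fin 3))
    (hF : ∀ n, ContDiff ℝ 3 (F n))
    (hb : ∀ m : ℕ, ∃ N : ℕ, ∃ B : ℝ, ∀ n, N ≤ n → ∀ y ∈ closedBall (0 : EuclideanSpace ℝ (Fin 3)) (m + 1),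
      ‖F n y‖ ≤ B ∧ ‖fderiv ℝ (F n) y‖ ≤ B ∧ ‖fderiv ℝ (fderiv ℝ (F n)) y‖ ≤ B ∧
      ‖fderiv ℝ (fderiv ℝ (fderiv ℝ (F n))) y‖ ≤ B) :
    ∃ φ : ℕ → ℕ, StrictMono φ ∧
      ∃ (G : EuclideanSpace ℝ (Fin 3) → EuclideanSpace ℝ (Fin 3))
        (G₁ : EuclideanSpace ℝ (Fin 3) → EuclideanSpace ℝ (Fin 3) →L[ℝ] EuclideanSpace ℝ (Fin 3))
        (G₂ : EuclideanSpace ℝ (Fin 3) →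
          EuclideanSpace ℝ (Fin 3) →L[ℝ] EuclideanSpace ℝ (Fin 3) →L[ℝ] EuclideanSpace ℝ (Fin 3)),
      ∀ m : ℕ,
        TendstoUniformlyOn (fun n => F (φ n)) G atTop (closedBall 0 (m + 1)) ∧
        TendstoUniformlyOn (fun n => fderiv ℝ (F (φ n))) G₁ atTop (closedBall 0 (m + 1)) ∧
        TendstoUniformlyOn (fun n => fderiv ℝ (fderiv ℝ (F (φ n)))) G₂ atTop
          (closedBall 0 (m + 1)) := by
  -- the bundle `T n y = (F n y, DF n y, D²F n y)` (kept opaque)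
  obtain ⟨T, hT⟩ : ∃ T : ℕ → (EuclideanSpace ℝ (Fin 3)) →
      (EuclideanSpace ℝ (Fin 3)) × (((EuclideanSpace ℝ (Fin 3)) →L[ℝ] (EuclideanSpace ℝ (Fin 3))) ×
        ((EuclideanSpace ℝ (Fin 3)) →L[ℝ] (EuclideanSpace ℝ (Fin 3)) →L[ℝ] (EuclideanSpace ℝ (Fin 3)))),
      ∀ n, T n = fun y => (F n y, fderiv ℝ (F n) y, fderiv ℝ (fderiv ℝ (F n)) y) :=
    ⟨_, fun _ => rfl⟩
  have hF2 : ∀ n, ContDiff ℝ 2 (fderiv ℝ (F n)) := fun n =>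
    ContDiff.fderiv_right (hF n) (m := 2) (by norm_num)
  have hF1 : ∀ n, ContDiff ℝ 1 (fderiv ℝ (fderiv ℝ (F n))) := fun n =>
    ContDiff.fderiv_right (hF2 n) (m := 1) (by norm_num)
  have hTc : ∀ n, Continuous (T n) := fun n => by
    rw [hT n]
    exact (hF n).continuous.prodMk ((hF2 n).continuous.prodMk (hF1 n).continuous)
  -- Lipschitz bounds on the balls
  choose N B hNB using hb
  have hLip : ∀ m n, N m ≤ n → LipschitzOnWith (Real.toNNReal (B m)) (T n)
      (closedBall (0 : (EuclideanSpace ℝ (Fin 3))) (m + 1)) := by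
    intro m n hn
    have hconv : Convex ℝ (closedBall (0 : (EuclideanSpace ℝ (Fin 3))) (m + 1)) := convex_closedBall _ _
    rw [lipschitzOnWith_iff_norm_sub_le]
    intro x hx y hy
    have hB0 : B m ≤ Real.toNNReal (B m) := Real.le_coe_toNNReal _
    -- the three components
    have h0 : ‖F n x - F n y‖ ≤ Real.toNNReal (B m) * ‖x - y‖ := by
      refine hconv.norm_image_sub_le_of_norm_fderiv_le (fun z _ => (hF n).differentiable
        (by norm_num) z) (fun z hz => ((hNB m n hn z hz).2.1).trans hB0) hy hx
    have h1 : ‖fderiv ℝ (F n) x - fderiv ℝ (F n) y‖ ≤ Real.toNNReal (B m) * ‖x - y‖ := by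
      refine hconv.norm_image_sub_le_of_norm_fderiv_le (fun z _ => (hF2 n).differentiable
        (by norm_num) z) (fun z hz => ((hNB m n hn z hz).2.2.1).trans hB0) hy hx
    have h2 : ‖fderiv ℝ (fderiv ℝ (F n)) x - fderiv ℝ (fderiv ℝ (F n)) y‖ ≤
        Real.toNNReal (B m) * ‖x - y‖ := by
      refine hconv.norm_image_sub_le_of_norm_fderiv_le (fun z _ => (hF1 n).differentiable
        (by norm_num) z) (fun z hz => ((hNB m n hn z hz).2.2.2).trans hB0) hy hx
    simp only [hT n, Prod.norm_def, Prod.fst_sub, Prod.snd_sub, max_le_iff]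
    exact ⟨h0, h1, h2⟩
  have hbd : ∀ m n, N m ≤ n → ∀ y ∈ closedBall (0 : (EuclideanSpace ℝ (Fin 3))) (m + 1), ‖T n y‖ ≤ B m := by
    intro m n hn y hy
    obtain ⟨h0, h1, h2, -⟩ := hNB m n hn y hy
    simp only [hT n, Prod.norm_def, max_le_iff]
    exact ⟨h0, h1, h2⟩
  -- the compact balls as compact spaces, and the restricted bundles
  set K : ℕ → Type := fun m => closedBall (0 : (EuclideanSpace ℝ (Fin 3))) (m + 1) with hK
  haveI : ∀ m, CompactSpace (K m) := fun m =>
    isCompact_iff_compactSpace.1 (isCompact_closedBall (0 : (EuclideanSpace ℝ (Fin 3))) (m + 1))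
  set g : ∀ m : ℕ, ℕ → (K m →ᵇ (EuclideanSpace ℝ (Fin 3)) × (((EuclideanSpace ℝ (Fin 3)) →L[ℝ] (EuclideanSpace ℝ (Fin 3))) × ((EuclideanSpace ℝ (Fin 3)) →L[ℝ] (EuclideanSpace ℝ (Fin 3)) →L[ℝ] (EuclideanSpace ℝ (Fin 3))))) := fun m n =>
    BoundedContinuousFunction.mkOfCompact ⟨fun y => T n y, (hTc n).comp continuous_subtype_val⟩
    with hg
  have hg_apply : ∀ m n (y : K m), g m n y = T n y := fun m n y => rfl
  -- Arzelà–Ascoli on each ball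
  have hcomp : ∀ m, IsCompact (closure ((g m) '' {n | N m ≤ n})) := by
    intro m
    refine arzela_ascoli (closedBall 0 (B m)) (isCompact_closedBall _ _) _ ?_ ?_
    · rintro f y ⟨n, hn, rfl⟩
      rw [mem_closedBall_zero_iff, hg_apply]
      exact hbd m n hn y y.2
    · refine (LipschitzWith.uniformEquicontinuous _ (Real.toNNReal (B m)) ?_).equicontinuous
      rintro ⟨f, n, hn, rfl⟩
      have h := (hLip m n hn).to_restrict
      intro x y
      exact h x y
  set C : ∀ m : ℕ, Set (K m →ᵇ (EuclideanSpace ℝ (Fin 3)) × (((EuclideanSpace ℝ (Fin 3)) →L[ℝ] (EuclideanSpace ℝ (Fin 3))) × ((EuclideanSpace ℝ (Fin 3)) →L[ℝ] (EuclideanSpace ℝ (Fin 3)) →L[ℝ] (EuclideanSpace ℝ (Fin 3))))) := fun m =>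
    closure ((g m) '' {n | N m ≤ n}) ∪ (g m) '' {n | n < N m} with hC
  have hCc : ∀ m, IsCompact (C m) := fun m =>
    (hcomp m).union (((finite_lt_nat (N m)).image _).isCompact)
  have hmemC : ∀ n m, g m n ∈ C m := by
    intro n m
    by_cases h : N m ≤ n
    · exact Or.inl (subset_closure ⟨n, h, rfl⟩)
    · exact Or.inr ⟨n, not_le.1 h, rfl⟩
  -- one subsequence for all balls (Tychonoff + first countability of the countable product)
  have hS : IsCompact (Set.pi univ C) := isCompact_univ_pi hCc
  obtain ⟨L, -, φ, hφ, hL⟩ := hS.tendsto_subseq (x := fun n m => g m n)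
    (fun n => mem_univ_pi.2 fun m => hmemC n m)
  have hLm : ∀ m, TendstoUniformly (fun n => ⇑(g m (φ n))) (⇑(L m)) atTop := by
    intro m
    rw [← BoundedContinuousFunction.tendsto_iff_tendstoUniformly]
    exact (continuous_apply m).continuousAt.tendsto.comp hL
  -- pointwise limits and their independence of the ball
  have hpt : ∀ m (y : K m), Tendsto (fun n => T (φ n) y) atTop (𝓝 (L m y)) := by
    intro m y
    have := (hLm m).tendsto_at y
    simpa only [hg_apply] using this
  have hmem_self : ∀ y : (EuclideanSpace ℝ (Fin 3)), y ∈ closedBall (0 : (EuclideanSpace ℝ (Fin 3))) ((⌊‖y‖⌋₊ : ℕ) + 1) := fun y => by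
    rw [mem_closedBall_zero_iff]
    exact (Nat.lt_floor_add_one ‖y‖).le
  set G : (EuclideanSpace ℝ (Fin 3)) → (EuclideanSpace ℝ (Fin 3)) := fun y => (L ⌊‖y‖⌋₊ ⟨y, hmem_self y⟩).1 with hG
  set G₁ : (EuclideanSpace ℝ (Fin 3)) → (EuclideanSpace ℝ (Fin 3)) →L[ℝ] (EuclideanSpace ℝ (Fin 3)) := fun y => (L ⌊‖y‖⌋₊ ⟨y, hmem_self y⟩).2.1 with hG₁
  set G₂ : (EuclideanSpace ℝ (Fin 3)) → (EuclideanSpace ℝ (Fin 3)) →L[ℝ] (EuclideanSpace ℝ (Fin 3)) →L[ℝ] (EuclideanSpace ℝ (Fin 3)) := fun y => (L ⌊‖y‖⌋₊ ⟨y, hmem_self y⟩).2.2 with hG₂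
  have hident : ∀ (m : ℕ) (y : (EuclideanSpace ℝ (Fin 3)))
      (hy : y ∈ closedBall (0 : (EuclideanSpace ℝ (Fin 3))) (m + 1)),
      L m ⟨y, hy⟩ = (G y, G₁ y, G₂ y) := by
    intro m y hy
    have h1 := hpt m ⟨y, hy⟩
    have h2 := hpt ⌊‖y‖⌋₊ ⟨y, hmem_self y⟩
    have := tendsto_nhds_unique h1 h2
    rw [this]
  refine ⟨φ, hφ, G, G₁, G₂, fun m => ?_⟩
  have key : ∀ ε > 0, ∀ᶠ n in atTop, ∀ y ∈ closedBall (0 : (EuclideanSpace ℝ (Fin 3))) (m + 1),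
      dist ((G y, G₁ y, G₂ y)) (T (φ n) y) < ε := by
    intro ε hε
    filter_upwards [Metric.tendstoUniformly_iff.1 (hLm m) ε hε] with n hn y hy
    have := hn ⟨y, hy⟩
    rwa [hident m y hy, hg_apply] at this
  refine ⟨?_, ?_, ?_⟩
  · rw [Metric.tendstoUniformlyOn_iff]
    intro ε hε
    filter_upwards [key ε hε] with n hn y hy
    have h := hn y hy
    rw [hT (φ n)] at h
    simp only [Prod.dist_eq, max_lt_iff] at h
    exact h.1
  · rw [Metric.tendstoUniformlyOn_iff]
    intro ε hε
    filter_upwards [key ε hε] with n hn y hy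
    have h := hn y hy
    rw [hT (φ n)] at h
    simp only [Prod.dist_eq, max_lt_iff] at h
    exact h.2.1
  · rw [Metric.tendstoUniformlyOn_iff]
    intro ε hε
    filter_upwards [key ε hε] with n hn y hy
    have h := hn y hy
    rw [hT (φ n)] at h
    simp only [Prod.dist_eq, max_lt_iff] at h
    exact h.2.2

/-- **The `C²` limit.** Under uniform convergence of `Fₙ`, `DFₙ`, `D²Fₙ` on every ball
`B̄(0, m+1)` (as produced by `exists_subseq_tendstoUniformlyOn_of_bounds`) the limits satisfy
`DG = G₁`, `DG₁ = G₂`, `G ∈ C²` and `G₂` is continuous (differentiation of uniform limits,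
Mathlib's `hasFDerivAt_of_tendstoUniformlyOn`). [folklore] -/
theorem hasFDerivAt_limits_of_tendstoUniformlyOn
    (F : ℕ → EuclideanSpace ℝ (Fin 3) → EuclideanSpace ℝ (Fin 3))
    (hF : ∀ n, ContDiff ℝ 3 (F n))
    {G : EuclideanSpace ℝ (Fin 3) → EuclideanSpace ℝ (Fin 3)}
    {G₁ : EuclideanSpace ℝ (Fin 3) → EuclideanSpace ℝ (Fin 3) →L[ℝ] EuclideanSpace ℝ (Fin 3)}
    {G₂ : EuclideanSpace ℝ (Fin 3) →
      EuclideanSpace ℝ (Fin 3) →L[ℝ] EuclideanSpace ℝ (Fin 3) →L[ℝ] EuclideanSpace ℝ (Fin 3)}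
    (h : ∀ m : ℕ,
      TendstoUniformlyOn F G atTop (closedBall 0 (m + 1)) ∧
      TendstoUniformlyOn (fun n => fderiv ℝ (F n)) G₁ atTop (closedBall 0 (m + 1)) ∧
      TendstoUniformlyOn (fun n => fderiv ℝ (fderiv ℝ (F n))) G₂ atTop (closedBall 0 (m + 1))) :
    (∀ y, HasFDerivAt G (G₁ y) y) ∧ (∀ y, HasFDerivAt G₁ (G₂ y) y) ∧ Continuous G₂ ∧
      ContDiff ℝ 2 G := by
  have hF2 : ∀ n, ContDiff ℝ 2 (fderiv ℝ (F n)) := fun n =>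
    ContDiff.fderiv_right (hF n) (m := 2) (by norm_num)
  have hF1 : ∀ n, ContDiff ℝ 1 (fderiv ℝ (fderiv ℝ (F n))) := fun n =>
    ContDiff.fderiv_right (hF2 n) (m := 1) (by norm_num)
  have hmem : ∀ y : EuclideanSpace ℝ (Fin 3), y ∈ ball (0 : EuclideanSpace ℝ (Fin 3)) ((⌊‖y‖⌋₊ : ℕ) + 1) :=
    fun y => by
      rw [mem_ball_zero_iff]
      exact Nat.lt_floor_add_one ‖y‖
  have hsub : ∀ m : ℕ, ball (0 : EuclideanSpace ℝ (Fin 3)) (m + 1) ⊆ closedBall 0 (m + 1) :=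
    fun m => ball_subset_closedBall
  -- `DG = G₁`
  have hG : ∀ y, HasFDerivAt G (G₁ y) y := by
    intro y
    set m : ℕ := ⌊‖y‖⌋₊
    obtain ⟨h0, h1, -⟩ := h m
    refine hasFDerivAt_of_tendstoUniformlyOn isOpen_ball (h1.mono (hsub m))
      (fun n x _ => ((hF n).differentiable (by norm_num) x).hasFDerivAt)
      (fun x hx => (h0.mono (hsub m)).tendsto_at hx) (hmem y)
  -- `DG₁ = G₂`
  have hG₁ : ∀ y, HasFDerivAt G₁ (G₂ y) y := by
    intro y
    set m : ℕ := ⌊‖y‖⌋₊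
    obtain ⟨-, h1, h2⟩ := h m
    refine hasFDerivAt_of_tendstoUniformlyOn isOpen_ball (h2.mono (hsub m))
      (fun n x _ => ((hF2 n).differentiable (by norm_num) x).hasFDerivAt)
      (fun x hx => (h1.mono (hsub m)).tendsto_at hx) (hmem y)
  -- `G₂` is continuous
  have hG₂ : Continuous G₂ := by
    rw [continuous_iff_continuousAt]
    intro y
    set m : ℕ := ⌊‖y‖⌋₊
    obtain ⟨-, -, h2⟩ := h m
    have hc : ContinuousOn G₂ (ball (0 : EuclideanSpace ℝ (Fin 3)) (m + 1)) :=
      (h2.mono (hsub m)).continuousOn (Frequently.of_forall fun n => (hF1 n).continuous.continuousOn)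
    exact hc.continuousAt (isOpen_ball.mem_nhds (hmem y))
  refine ⟨hG, hG₁, hG₂, ?_⟩
  -- `G ∈ C²`
  have e1 : fderiv ℝ G = G₁ := funext fun y => (hG y).fderiv
  have e2 : fderiv ℝ G₁ = G₂ := funext fun y => (hG₁ y).fderiv
  have hG₁c : ContDiff ℝ 1 G₁ := by
    rw [show (1 : WithTop ℕ∞) = 0 + 1 from rfl, contDiff_succ_iff_fderiv]
    refine ⟨fun y => (hG₁ y).differentiableAt, by simp, ?_⟩
    rw [e2]
    exact contDiff_zero.2 hG₂
  rw [show (2 : WithTop ℕ∞) = 1 + 1 from rfl, contDiff_succ_iff_fderiv]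
  refine ⟨fun y => (hG y).differentiableAt, by simp, ?_⟩
  rw [e1]
  exact hG₁c

end C2Compactness


section UniformLimitAlgebra

variable {X E F : Type*} [NormedAddCommGroup E] [NormedAddCommGroup F]

/-- A constant sequence converges uniformly. [folklore] -/
theorem tendstoUniformlyOn_const_seq (f : X → E) (s : Set X) :
    TendstoUniformlyOn (fun _ : ℕ => f) f atTop s := by
  rw [Metric.tendstoUniformlyOn_iff]
  intro ε hε
  exact Eventually.of_forall fun n x _ => by simpa using hε

/-- A uniform bound passes to a uniform (indeed pointwise) limit. [folklore] -/
theorem norm_le_of_tendstoUniformlyOn {A : ℕ → X → E} {A' : X → E} {s : Set X} {B : ℝ}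
    (h : TendstoUniformlyOn A A' atTop s) (hb : ∀ᶠ n in atTop, ∀ x ∈ s, ‖A n x‖ ≤ B) :
    ∀ x ∈ s, ‖A' x‖ ≤ B := by
  intro x hx
  have ht : Tendsto (fun n => A n x) atTop (𝓝 (A' x)) := h.tendsto_at hx
  exact le_of_tendsto ht.norm (hb.mono fun n hn => hn x hx)

variable [NormedSpace ℝ E] [NormedSpace ℝ F]

/-- **Uniform convergence of `Aₙ(x)[vₙ(x)]`** from uniform convergence of bounded operator
fields `Aₙ → A` and bounded vector fields `vₙ → v`. [folklore] -/
theorem tendstoUniformlyOn_clm_apply_of_bound {A : ℕ → X → E →L[ℝ] F} {A' : X → E →L[ℝ] F}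
    {v : ℕ → X → E} {v' : X → E} {s : Set X} {B₁ B₂ : ℝ}
    (hA : TendstoUniformlyOn A A' atTop s) (hv : TendstoUniformlyOn v v' atTop s)
    (hvB : ∀ᶠ n in atTop, ∀ x ∈ s, ‖v n x‖ ≤ B₁) (hAB : ∀ x ∈ s, ‖A' x‖ ≤ B₂) :
    TendstoUniformlyOn (fun n x => A n x (v n x)) (fun x => A' x (v' x)) atTop s := by
  rw [Metric.tendstoUniformlyOn_iff] at hA hv ⊢
  intro ε hε
  have hden : 0 < |B₁| + |B₂| + 1 := by positivity
  set η : ℝ := ε / (|B₁| + |B₂| + 1) with hη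
  have hη0 : 0 < η := div_pos hε hden
  filter_upwards [hA η hη0, hv η hη0, hvB] with n hAn hvn hBn x hx
  simp only [dist_eq_norm] at hAn hvn ⊢
  have e : A' x (v' x) - A n x (v n x) = (A' x - A n x) (v n x) + A' x (v' x - v n x) := by
    simp only [FunLike.coe_sub, Pi.sub_apply, map_sub]; abel
  rw [e]
  have hkey : η * (|B₁| + |B₂| + 1) = ε := div_mul_cancel₀ _ hden.ne'
  calc ‖(A' x - A n x) (v n x) + A' x (v' x - v n x)‖
      ≤ ‖A' x - A n x‖ * ‖v n x‖ + ‖A' x‖ * ‖v' x - v n x‖ :=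
        (norm_add_le _ _).trans
          (add_le_add (ContinuousLinearMap.le_opNorm _ _) (ContinuousLinearMap.le_opNorm _ _))
    _ ≤ η * |B₁| + |B₂| * η := by
        gcongr
        · exact (hAn x hx).le
        · exact (hBn x hx).trans (le_abs_self _)
        · exact (hAB x hx).trans (le_abs_self _)
        · exact (hvn x hx).le
    _ < ε := by nlinarith [abs_nonneg B₁, abs_nonneg B₂]

/-- The special case of a fixed vector: `Aₙ(x)[w] → A(x)[w]` uniformly. [folklore] -/
theorem tendstoUniformlyOn_clm_apply_const {A : ℕ → X → E →L[ℝ] F} {A' : X → E →L[ℝ] F}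
    {s : Set X} (hA : TendstoUniformlyOn A A' atTop s) (w : E) :
    TendstoUniformlyOn (fun n x => A n x w) (fun x => A' x w) atTop s := by
  rw [Metric.tendstoUniformlyOn_iff] at hA ⊢
  intro ε hε
  have hη0 : 0 < ε / (‖w‖ + 1) := div_pos hε (by positivity)
  filter_upwards [hA _ hη0] with n hAn x hx
  simp only [dist_eq_norm] at hAn ⊢
  have hkey : ε / (‖w‖ + 1) * (‖w‖ + 1) = ε := div_mul_cancel₀ _ (by positivity)
  calc ‖A' x w - A n x w‖ = ‖(A' x - A n x) w‖ := by simp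
    _ ≤ ‖A' x - A n x‖ * ‖w‖ := ContinuousLinearMap.le_opNorm _ _
    _ ≤ ε / (‖w‖ + 1) * ‖w‖ := by gcongr; exact (hAn x hx).le
    _ < ε := by nlinarith [norm_nonneg w]

end UniformLimitAlgebra

section PressureLimit

/-- **A limit of gradients is a gradient**: if `∇Qₙ = Wₙ` everywhere and `Wₙ → W` uniformly on
every ball, then `W = ∇P` for some `P` (normalise `Qₙ(0) = 0`; the normalised potentials are
uniformly Cauchy on balls by the mean value inequality, and the limit is differentiated under
the uniform convergence of the derivatives). [folklore] -/
theorem exists_hasGradientAt_of_tendstoUniformlyOn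
    {Q : ℕ → EuclideanSpace ℝ (Fin 3) → ℝ}
    {W : ℕ → EuclideanSpace ℝ (Fin 3) → EuclideanSpace ℝ (Fin 3)}
    {W' : EuclideanSpace ℝ (Fin 3) → EuclideanSpace ℝ (Fin 3)}
    (hQ : ∀ n y, HasGradientAt (Q n) (W n y) y)
    (hW : ∀ m : ℕ, TendstoUniformlyOn W W' atTop
      (closedBall (0 : EuclideanSpace ℝ (Fin 3)) (m + 1))) :
    ∃ P : EuclideanSpace ℝ (Fin 3) → ℝ, ∀ y, HasGradientAt P (W' y) y := by
  -- normalised potentials and their Fréchet derivatives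
  obtain ⟨Qh, hQh⟩ : ∃ Qh : ℕ → EuclideanSpace ℝ (Fin 3) → ℝ, ∀ n, Qh n = fun y => Q n y - Q n 0 :=
    ⟨_, fun _ => rfl⟩
  obtain ⟨D, hD⟩ : ∃ D : ℕ → EuclideanSpace ℝ (Fin 3) → (EuclideanSpace ℝ (Fin 3) →L[ℝ] ℝ),
      ∀ n, D n = fun y => InnerProductSpace.toDual ℝ (EuclideanSpace ℝ (Fin 3)) (W n y) :=
    ⟨_, fun _ => rfl⟩
  obtain ⟨D', hD'⟩ : ∃ D' : EuclideanSpace ℝ (Fin 3) → (EuclideanSpace ℝ (Fin 3) →L[ℝ] ℝ),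
      D' = fun y => InnerProductSpace.toDual ℝ (EuclideanSpace ℝ (Fin 3)) (W' y) :=
    ⟨_, rfl⟩
  have hQd : ∀ n y, HasFDerivAt (Qh n) (D n y) y := fun n y => by
    rw [hQh, hD]
    exact (hasGradientAt_iff_hasFDerivAt.1 (hQ n y)).sub_const _
  have hDu : ∀ m : ℕ, TendstoUniformlyOn D D' atTop
      (closedBall (0 : EuclideanSpace ℝ (Fin 3)) (m + 1)) := fun m => by
    rw [Metric.tendstoUniformlyOn_iff]
    intro ε hε
    filter_upwards [(Metric.tendstoUniformlyOn_iff.1 (hW m)) ε hε] with n hn y hy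
    rw [hD, hD']
    exact ((InnerProductSpace.toDual ℝ (EuclideanSpace ℝ (Fin 3))).isometry.dist_eq (W' y)
      (W n y)).trans_lt (hn y hy)
  have hC : ∀ m : ℕ, UniformCauchySeqOn Qh atTop (ball (0 : EuclideanSpace ℝ (Fin 3)) (m + 1)) :=
    fun m =>
      uniformCauchySeqOn_ball_of_fderiv ((hDu m).mono ball_subset_closedBall).uniformCauchySeqOn
        (fun n y _ => hQd n y)
        (by
          have : (fun n => Qh n 0) = fun _ => (0 : ℝ) := by funext n; simp [hQh]
          rw [this]
          exact tendsto_const_nhds.cauchy_map)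
  have hmem : ∀ y : EuclideanSpace ℝ (Fin 3), ∃ m : ℕ, y ∈ ball (0 : EuclideanSpace ℝ (Fin 3)) (m + 1) :=
    fun y => by
      obtain ⟨m, hm⟩ := exists_nat_gt ‖y‖
      exact ⟨m, by rw [mem_ball_zero_iff]; linarith⟩
  have hpt : ∀ y, ∃ l : ℝ, Tendsto (fun n => Qh n y) atTop (𝓝 l) := fun y => by
    obtain ⟨m, hy⟩ := hmem y
    exact cauchySeq_tendsto_of_complete ((hC m).cauchy_map hy)
  choose P hP using hpt
  refine ⟨P, fun y => ?_⟩
  obtain ⟨m, hy⟩ := hmem y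
  have hU : TendstoUniformlyOn Qh P atTop (ball (0 : EuclideanSpace ℝ (Fin 3)) (m + 1)) :=
    (hC m).tendstoUniformlyOn_of_tendsto fun z _ => hP z
  have h := hasFDerivAt_of_tendstoUniformlyOn isOpen_ball ((hDu m).mono ball_subset_closedBall)
    (fun n z _ => hQd n z) (fun z _ => hP z) hy
  rw [hD'] at h
  exact hasGradientAt_iff_hasFDerivAt.2 h

/-- A function with a continuous gradient field is `C¹`. [folklore] -/
theorem contDiff_one_of_hasGradientAt {P : EuclideanSpace ℝ (Fin 3) → ℝ}
    {W : EuclideanSpace ℝ (Fin 3) → EuclideanSpace ℝ (Fin 3)}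
    (h : ∀ y, HasGradientAt P (W y) y) (hW : Continuous W) : ContDiff ℝ 1 P := by
  rw [contDiff_one_iff_fderiv]
  refine ⟨fun y => (h y).differentiableAt, ?_⟩
  have e : fderiv ℝ P = fun y => InnerProductSpace.toDual ℝ (EuclideanSpace ℝ (Fin 3)) (W y) :=
    funext fun y => (hasGradientAt_iff_hasFDerivAt.1 (h y)).fderiv
  rw [e]
  exact (InnerProductSpace.toDual ℝ (EuclideanSpace ℝ (Fin 3))).continuous.comp hW

/-- The Laplacian of a vector field on `ℝ³` through the second Fréchet derivative and the
standard basis: `ΔF(y) = ∑ᵢ D²F(y)[eᵢ, eᵢ]`. [folklore] -/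
theorem laplacian_apply_eq_sum_fderiv_fderiv_basisFun
    (f : EuclideanSpace ℝ (Fin 3) → EuclideanSpace ℝ (Fin 3)) (y : EuclideanSpace ℝ (Fin 3)) :
    (Δ f) y = ∑ i, fderiv ℝ (fderiv ℝ f) y (EuclideanSpace.basisFun (Fin 3) ℝ i)
      (EuclideanSpace.basisFun (Fin 3) ℝ i) := by
  rw [InnerProductSpace.laplacian_eq_iteratedFDeriv_orthonormalBasis f
    (EuclideanSpace.basisFun (Fin 3) ℝ)]
  simp only [iteratedFDeriv_two_apply, Matrix.cons_val_zero, Matrix.cons_val_one]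

/-- Continuity of the trace on `ℝ³ →L ℝ³` (finite dimension). [folklore] -/
theorem continuous_trace_clm :
    Continuous fun A : EuclideanSpace ℝ (Fin 3) →L[ℝ] EuclideanSpace ℝ (Fin 3) =>
      LinearMap.trace ℝ (EuclideanSpace ℝ (Fin 3)) (A : EuclideanSpace ℝ (Fin 3) →ₗ[ℝ] EuclideanSpace ℝ (Fin 3)) :=
  ((LinearMap.trace ℝ (EuclideanSpace ℝ (Fin 3))) ∘ₗ
    (ContinuousLinearMap.coeLM ℝ :
      (EuclideanSpace ℝ (Fin 3) →L[ℝ] EuclideanSpace ℝ (Fin 3)) →ₗ[ℝ]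
        (EuclideanSpace ℝ (Fin 3) →ₗ[ℝ] EuclideanSpace ℝ (Fin 3)))).continuous_of_finiteDimensional

end PressureLimit

end Literature.Analysis.FluidPDE

end
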